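import Mathlib.Topology.Compactification.OnePoint.Basic
import Mathlib.NumberTheory.NumberField.InfinitePlace.Embeddings
import Literature.NumberTheory.DiophantineGeometry.GenEllThm21
import Literature.NumberTheory.LocalFields.PadicFiniteSubextensions
import HarnessLib

/-!
# [GenEll] Thm. 2.1, proof, Step "(ii) ⟹ (i)": the compactness of conjugate configurations in
# bounded degree, as a finite-subcover theorem

S. Mochizuki, *Arithmetic elliptic curves in general position*, Math. J. Okayama Univ. 52 (2010),
proof of Theorem 2.1, p. 12 (kurims manuscript): the reduction of statement (i) to statement (ii)
selects, for a family of points of bounded degree `d`, finitely many "mechanisms" (there: a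
noncritical Belyi map adapted to a limit configuration, p. 12 "by the compactness of the set of
rational points of [the curve] over any finite extension of `ℚ_v`", together with "there are only
finitely many extensions of `ℚ_v` of bounded degree"). [cite: MochizukiGenEll2010, Thm 2.1 proof p.12]

This file isolates that compactness step, for `X = ℙ¹` and the places `∞` and one prime `p`, in
the vocabulary of `GenEllProjLine` (`NFPoint`: a point is `(F, x)`, its conjugates at `∞` are the
`σ x`, `σ : F →+* ℂ`, and at `p` the `σ x`, `σ : F →+* Q̄_p`, `Q̄_p = PadicAlgCl p`, exactly as in
`CBData.Mem` and `NFPoint.FarFromCusps`).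

* A *covering mechanism* `i : ι` is a pair of OPEN sets `Uarc i ⊆ ℂ`, `Unon i ⊆ Q̄_p`, each of which
  may in addition be declared "open at `∞`" (`i ∈ Iarc`, resp. `i ∈ Inon`), in which case it must
  contain a punctured neighbourhood `{‖z‖ > R}` of `∞`. The mechanism *applies* to `P` when every
  complex conjugate of `P.x` lies in `Uarc i` and every `Q̄_p`-conjugate lies in `Unon i`.
* `exists_finset_cover_of_degree_le` (**finite subcover**): if every CONFIGURATION — a `d`-tuple of
  points of `ℙ¹(ℂ) = ℂ ∪ {∞}` and a `d`-tuple of points of `Q̄_p ∪ {∞}` — is contained in some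
  mechanism (a tuple entry `∞` being allowed exactly for mechanisms open at `∞`), then FINITELY
  MANY mechanisms apply to all points of degree `≤ d`.
* `vojtaIneq_univ_of_cover` (**the form consumed by the proof of Thm. 2.1 (ii) ⟹ (i)**): if moreover
  the Vojta inequality `ht ≲ (1+ε)(log-diff + log-cond)` holds in degree `≤ d` on the set of points
  to which each single mechanism applies, it holds on all of `U_P(Q̄)^{≤ d}` (a finite union of
  bounded-discrepancy inequalities).

PROOF. Every `Q̄_p`-conjugate of a point of degree `≤ d` generates an extension of `ℚ_p` of degree
`≤ d`; there are only finitely many such extensions inside `Q̄_p` (tree: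
`LocalFields.finite_setOf_intermediateField_finrank_le`, Krasner), so all these conjugates lie in
ONE finite extension `L_d` (`exists_intermediateField_forall_conj_mem`), which is locally compact.
The configuration space `(ℙ¹(ℂ))^d × (ℙ¹(L_d))^d` (one-point compactifications) is compact, each
mechanism cuts out an open subset of it, and the hypothesis says these open sets cover; a finite
subcover covers in particular the configuration of conjugates of every point of degree `≤ d`.

Everything here is classical point-set topology and field theory (Mathlib), PROVED; nothing in this
file bears on anything disputed. No new definitions: mechanisms are unbundled families of sets.
-/

noncomputable section

open NumberField Set OnePoint

namespace Literature.NumberTheory.DiophantineGeometry.GenEll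

/-! ## All `Q̄_p`-conjugates of points of bounded degree lie in one finite extension of `ℚ_p` -/

/-- For every `d` there is ONE finite extension `L_d ⊆ Q̄_p` of `ℚ_p` containing every
`Q̄_p`-conjugate `σ x` of every element `x` of every number field `F` with `[F:ℚ] ≤ d` ("there are
only finitely many extensions of `ℚ_v` of degree `≤ d`", and `ℚ_p(σ x)` is one of them).
[cite: MochizukiGenEll2010, Thm 2.1 proof p.12] -/
theorem exists_intermediateField_forall_conj_mem (p : ℕ) [Fact p.Prime] (d : ℕ) :
    ∃ L : IntermediateField ℚ_[p] (PadicAlgCl p), FiniteDimensional ℚ_[p] L ∧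
      ∀ (F : Type) [Field F] [NumberField F], Module.finrank ℚ F ≤ d →
        ∀ (σ : F →+* PadicAlgCl p) (x : F), σ x ∈ L := by
  set S : Set (IntermediateField ℚ_[p] (PadicAlgCl p)) :=
    {E | FiniteDimensional ℚ_[p] E ∧ Module.finrank ℚ_[p] E ≤ d} with hS_def
  have hSfin : S.Finite := LocalFields.finite_setOf_intermediateField_finrank_le p d
  haveI : Finite S := hSfin.to_subtype
  haveI : ∀ E : S, FiniteDimensional ℚ_[p] (E : IntermediateField ℚ_[p] (PadicAlgCl p)) :=
    fun E => E.2.1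
  refine ⟨⨆ E : S, (E : IntermediateField ℚ_[p] (PadicAlgCl p)),
    IntermediateField.finiteDimensional_iSup_of_finite, ?_⟩
  intro F _ _ hF σ x
  -- `y := σ x` is integral over `ℚ`, hence over `ℚ_p`, with `[ℚ_p(y) : ℚ_p] ≤ [ℚ(x) : ℚ] ≤ d`.
  have hxint : IsIntegral ℚ x := Algebra.IsIntegral.isIntegral x
  have hyintQ : IsIntegral ℚ (σ x) := by
    simpa using hxint.map σ.toRatAlgHom
  have hyint : IsIntegral ℚ_[p] (σ x) := hyintQ.tower_top
  have hmin : minpoly ℚ (σ x) = minpoly ℚ x :=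
    minpoly.algHom_eq σ.toRatAlgHom σ.injective x
  have hdeg : (minpoly ℚ_[p] (σ x)).natDegree ≤ d := by
    have hdvd : minpoly ℚ_[p] (σ x) ∣ (minpoly ℚ (σ x)).map (algebraMap ℚ ℚ_[p]) :=
      minpoly.dvd_map_of_isScalarTower ℚ ℚ_[p] (σ x)
    have hne : (minpoly ℚ (σ x)).map (algebraMap ℚ ℚ_[p]) ≠ 0 :=
      Polynomial.map_ne_zero (minpoly.ne_zero hyintQ)
    calc (minpoly ℚ_[p] (σ x)).natDegree
        ≤ ((minpoly ℚ (σ x)).map (algebraMap ℚ ℚ_[p])).natDegree :=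
          Polynomial.natDegree_le_of_dvd hdvd hne
      _ = (minpoly ℚ x).natDegree := by rw [Polynomial.natDegree_map, hmin]
      _ ≤ Module.finrank ℚ F := minpoly.natDegree_le x
      _ ≤ d := hF
  have hE : IntermediateField.adjoin ℚ_[p] {σ x} ∈ S := by
    refine ⟨IntermediateField.adjoin.finiteDimensional hyint, ?_⟩
    rw [IntermediateField.adjoin.finrank hyint]
    exact hdeg
  have hle : IntermediateField.adjoin ℚ_[p] {σ x} ≤
      ⨆ E : S, (E : IntermediateField ℚ_[p] (PadicAlgCl p)) :=
    le_iSup (fun E : S => (E : IntermediateField ℚ_[p] (PadicAlgCl p))) ⟨_, hE⟩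
  exact hle (IntermediateField.mem_adjoin_simple_self ℚ_[p] (σ x))

/-! ## Open subsets of a one-point compactification cut out by an open set and a flag at `∞` -/

/-- In a proper normed group `X` (e.g. `ℂ`, or a finite extension of `ℚ_p`), the subset of
`X ∪ {∞}` consisting of (the image of) an open set `U ⊆ X`, together with `∞` when the flag `I`
holds — in which case `U` is required to contain a punctured neighbourhood `{‖z‖ > R}` of `∞` — is
OPEN in the one-point compactification. [cite: MochizukiGenEll2010, Thm 2.1 proof p.12] -/
theorem isOpen_setOf_coe_mem_or_infty {X : Type*} [SeminormedAddCommGroup X] [ProperSpace X]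
    {U : Set X} (hU : IsOpen U) {I : Prop} (hI : I → ∃ R : ℝ, ∀ z : X, R < ‖z‖ → z ∈ U) :
    IsOpen {ω : OnePoint X | (∃ z ∈ U, ω = ↑z) ∨ (ω = ∞ ∧ I)} := by
  by_cases hi : I
  · obtain ⟨R, hR⟩ := hI hi
    have hmem : (∞ : OnePoint X) ∈ {ω : OnePoint X | (∃ z ∈ U, ω = ↑z) ∨ (ω = ∞ ∧ I)} :=
      Or.inr ⟨rfl, hi⟩
    rw [OnePoint.isOpen_iff_of_mem hmem]
    have hpre : ((↑) ⁻¹' {ω : OnePoint X | (∃ z ∈ U, ω = ↑z) ∨ (ω = ∞ ∧ I)} : Set X) = U := by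
      ext z
      simp only [mem_preimage, mem_setOf_eq, OnePoint.coe_eq_coe, coe_ne_infty, false_and,
        or_false]
      constructor
      · rintro ⟨w, hw, rfl⟩; exact hw
      · intro hz; exact ⟨z, hz, rfl⟩
    rw [hpre]
    refine ⟨hU.isClosed_compl, ?_⟩
    refine (isCompact_closedBall (0 : X) R).of_isClosed_subset hU.isClosed_compl ?_
    intro z hz
    rw [mem_closedBall_zero_iff]
    by_contra h
    exact hz (hR z (lt_of_not_ge h))
  · have hset : {ω : OnePoint X | (∃ z ∈ U, ω = ↑z) ∨ (ω = ∞ ∧ I)} = ((↑) '' U : Set (OnePoint X)) := by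
      ext ω
      simp only [mem_setOf_eq, mem_image, hi, and_false, or_false]
      constructor
      · rintro ⟨z, hz, rfl⟩; exact ⟨z, hz, rfl⟩
      · rintro ⟨z, hz, rfl⟩; exact ⟨z, hz, rfl⟩
    rw [hset]
    exact OnePoint.isOpen_image_coe.mpr hU

/-! ## The finite-subcover theorem -/

/-- **Compactness of conjugate configurations in bounded degree (finite subcover).** Fix a prime
`p`, a degree bound `d`, and a family of covering mechanisms `i : ι`: open sets `Uarc i ⊆ ℂ` and
`Unon i ⊆ Q̄_p`, with `i ∈ Iarc` (resp. `i ∈ Inon`) meaning that `Uarc i` (resp. `Unon i`) also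
counts as a neighbourhood of the point `∞` of `ℙ¹` and then contains some `{‖z‖ > R}`. Suppose every
configuration `(a, b)` of `d` points of `ℂ ∪ {∞}` and `d` points of `Q̄_p ∪ {∞}` is contained in a
single mechanism (an entry `∞` being admissible precisely for mechanisms open at `∞`). Then there
is a FINITE set `s` of mechanisms such that for every point `P = (F, x)` with `[F:ℚ] ≤ d` some
`i ∈ s` applies to `P`: all complex conjugates `σ x` lie in `Uarc i` and all `Q̄_p`-conjugates lie in
`Unon i`. This is the step "by the compactness of the set of rational points … over any finite
extension of `ℚ_v`" of the printed proof. [cite: MochizukiGenEll2010, Thm 2.1 proof p.12] -/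
theorem exists_finset_cover_of_degree_le (p : ℕ) [Fact p.Prime] (d : ℕ) {ι : Type*}
    (Uarc : ι → Set ℂ) (hUarc : ∀ i, IsOpen (Uarc i))
    (Unon : ι → Set (PadicAlgCl p)) (hUnon : ∀ i, IsOpen (Unon i))
    (Iarc Inon : Set ι)
    (hIarc : ∀ i ∈ Iarc, ∃ R : ℝ, ∀ z : ℂ, R < ‖z‖ → z ∈ Uarc i)
    (hInon : ∀ i ∈ Inon, ∃ R : ℝ, ∀ z : PadicAlgCl p, R < ‖z‖ → z ∈ Unon i)
    (hcover : ∀ (a : Fin d → OnePoint ℂ) (b : Fin d → OnePoint (PadicAlgCl p)), ∃ i : ι,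
      (∀ j, (∃ z ∈ Uarc i, a j = ↑z) ∨ (a j = ∞ ∧ i ∈ Iarc)) ∧
        (∀ j, (∃ z ∈ Unon i, b j = ↑z) ∨ (b j = ∞ ∧ i ∈ Inon))) :
    ∃ s : Finset ι, ∀ P : NFPoint, P.degree ≤ d → ∃ i ∈ s,
      (∀ σ : P.F →+* ℂ, σ P.x ∈ Uarc i) ∧ (∀ σ : P.F →+* PadicAlgCl p, σ P.x ∈ Unon i) := by
  classical
  -- the finite extension `L = L_d` of `ℚ_p` containing all `Q̄_p`-conjugates in degree `≤ d`
  obtain ⟨L, hLfd, hL⟩ := exists_intermediateField_forall_conj_mem p d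
  haveI : FiniteDimensional ℚ_[p] L := hLfd
  haveI : ProperSpace L := FiniteDimensional.proper ℚ_[p] L
  -- the open subsets of the two one-point compactifications attached to a mechanism
  let A : ι → Set (OnePoint ℂ) := fun i =>
    {ω | (∃ z ∈ Uarc i, ω = ↑z) ∨ (ω = ∞ ∧ i ∈ Iarc)}
  let B : ι → Set (OnePoint L) := fun i =>
    {ω | (∃ y ∈ {y : L | (y : PadicAlgCl p) ∈ Unon i}, ω = ↑y) ∨ (ω = ∞ ∧ i ∈ Inon)}
  have hA : ∀ i, IsOpen (A i) := fun i =>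
    isOpen_setOf_coe_mem_or_infty (hUarc i) (hIarc i)
  have hB : ∀ i, IsOpen (B i) := fun i => by
    refine isOpen_setOf_coe_mem_or_infty ((hUnon i).preimage continuous_subtype_val) ?_
    intro hi
    obtain ⟨R, hR⟩ := hInon i hi
    exact ⟨R, fun y hy => hR (y : PadicAlgCl p) (by simpa using hy)⟩
  -- the open subsets of the compact configuration space
  let W : ι → Set ((Fin d → OnePoint ℂ) × (Fin d → OnePoint L)) := fun i =>
    {τ | (∀ j, τ.1 j ∈ A i) ∧ (∀ j, τ.2 j ∈ B i)}
  have hW : ∀ i, IsOpen (W i) := fun i => by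
    have h1 : IsOpen {τ : (Fin d → OnePoint ℂ) × (Fin d → OnePoint L) | ∀ j, τ.1 j ∈ A i} := by
      rw [show {τ : (Fin d → OnePoint ℂ) × (Fin d → OnePoint L) | ∀ j, τ.1 j ∈ A i} =
        ⋂ j, (fun τ => τ.1 j) ⁻¹' (A i) from by ext τ; simp]
      exact isOpen_iInter_of_finite fun j =>
        (hA i).preimage ((continuous_apply j).comp continuous_fst)
    have h2 : IsOpen {τ : (Fin d → OnePoint ℂ) × (Fin d → OnePoint L) | ∀ j, τ.2 j ∈ B i} := by
      rw [show {τ : (Fin d → OnePoint ℂ) × (Fin d → OnePoint L) | ∀ j, τ.2 j ∈ B i} =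
        ⋂ j, (fun τ => τ.2 j) ⁻¹' (B i) from by ext τ; simp]
      exact isOpen_iInter_of_finite fun j =>
        (hB i).preimage ((continuous_apply j).comp continuous_snd)
    exact h1.inter h2
  -- they cover, by the configuration hypothesis
  have hWcover : (univ : Set ((Fin d → OnePoint ℂ) × (Fin d → OnePoint L))) ⊆ ⋃ i, W i := by
    intro τ _
    obtain ⟨i, ha, hb⟩ := hcover τ.1 (fun j => (τ.2 j).map ((↑) : L → PadicAlgCl p))
    refine mem_iUnion.mpr ⟨i, ha, fun j => ?_⟩
    have hbj := hb j
    induction hτ : τ.2 j using OnePoint.rec with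
    | infty =>
      rw [hτ] at hbj
      rcases hbj with ⟨z, _, hz⟩ | ⟨_, hi⟩
      · exact absurd hz.symm (coe_ne_infty z)
      · exact Or.inr ⟨rfl, hi⟩
    | coe y =>
      rw [hτ] at hbj
      rcases hbj with ⟨z, hz, hyz⟩ | ⟨h, _⟩
      · refine Or.inl ⟨y, ?_, rfl⟩
        have : (y : PadicAlgCl p) = z := by
          simpa [OnePoint.map_some] using hyz
        show (y : PadicAlgCl p) ∈ Unon i
        rw [this]; exact hz
      · exact absurd h (by simp [OnePoint.map_some])
  obtain ⟨s, hs⟩ := isCompact_univ.elim_finite_subcover W hW hWcover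
  refine ⟨s, fun P hP => ?_⟩
  -- the configuration of conjugates of `P`
  haveI : IsAlgClosed (PadicAlgCl p) := AlgebraicClosure.isAlgClosed _
  have hcardC : Fintype.card (P.F →+* ℂ) ≤ Fintype.card (Fin d) := by
    rw [Fintype.card_fin, NumberField.Embeddings.card]; exact hP
  have hcardP : Fintype.card (P.F →+* PadicAlgCl p) ≤ Fintype.card (Fin d) := by
    rw [Fintype.card_fin, NumberField.Embeddings.card]; exact hP
  haveI : Nonempty (P.F →+* ℂ) := by
    rw [← Fintype.card_pos_iff, NumberField.Embeddings.card]; exact P.degree_pos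
  haveI : Nonempty (P.F →+* PadicAlgCl p) := by
    rw [← Fintype.card_pos_iff, NumberField.Embeddings.card]; exact P.degree_pos
  obtain ⟨eC⟩ := Function.Embedding.nonempty_of_card_le hcardC
  obtain ⟨eP⟩ := Function.Embedding.nonempty_of_card_le hcardP
  let gC : Fin d → (P.F →+* ℂ) := Function.invFun eC
  let gP : Fin d → (P.F →+* PadicAlgCl p) := Function.invFun eP
  have hgC : ∀ σ, gC (eC σ) = σ := Function.leftInverse_invFun eC.injective
  have hgP : ∀ σ, gP (eP σ) = σ := Function.leftInverse_invFun eP.injective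
  let τ : (Fin d → OnePoint ℂ) × (Fin d → OnePoint L) :=
    (fun j => ((gC j P.x : ℂ) : OnePoint ℂ),
      fun j => ((⟨gP j P.x, hL P.F hP (gP j) P.x⟩ : L) : OnePoint L))
  obtain ⟨i, hi, hτ⟩ := mem_iUnion₂.mp (hs (mem_univ τ))
  refine ⟨i, hi, fun σ => ?_, fun σ => ?_⟩
  · have h := hτ.1 (eC σ)
    rcases h with ⟨z, hz, hσz⟩ | ⟨h, _⟩
    · have h1 : (((gC (eC σ)) P.x : ℂ) : OnePoint ℂ) = ↑z := hσz
      have h2 : (gC (eC σ)) P.x = z := OnePoint.coe_injective h1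
      rw [hgC] at h2
      rw [h2]; exact hz
    · exact absurd h (coe_ne_infty _)
  · have h := hτ.2 (eP σ)
    rcases h with ⟨y, hy, hσy⟩ | ⟨h, _⟩
    · have h1 : (((⟨gP (eP σ) P.x, hL P.F hP (gP (eP σ)) P.x⟩ : L)) : OnePoint L) = ↑y := hσy
      have h2 : (⟨gP (eP σ) P.x, hL P.F hP (gP (eP σ)) P.x⟩ : L) = y := OnePoint.coe_injective h1
      have h' : (gP (eP σ)) P.x = (y : PadicAlgCl p) := by
        rw [← h2]
      rw [hgP] at h'
      rw [h']; exact hy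
    · exact absurd h (coe_ne_infty _)

/-! ## The form consumed by [GenEll] Thm. 2.1 (ii) ⟹ (i): a finite union of Vojta inequalities -/

/-- **Vojta in degree `≤ d` from a covering family of mechanisms.** With the data and covering
hypothesis of `exists_finset_cover_of_degree_le`: if for every mechanism `i` the inequality of
BD-classes `ht_{ω_P(C)} ≲ (1+ε)(log-diff_P + log-cond_C)` holds on the points of `U_P(Q̄)^{≤d}` to
which `i` applies (`VojtaIneq {P | …} d ε`), then it holds on all of `U_P(Q̄)^{≤d}`
(`VojtaIneq Set.univ d ε`, the `ε`-instance of `VojtaP1Deg d`): finitely many mechanisms suffice,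
and a finite union of bounded-discrepancy inequalities is one. [cite: MochizukiGenEll2010, Thm 2.1 proof p.12] -/
theorem vojtaIneq_univ_of_cover (p : ℕ) [Fact p.Prime] (d : ℕ) {ε : ℝ} {ι : Type*}
    (Uarc : ι → Set ℂ) (hUarc : ∀ i, IsOpen (Uarc i))
    (Unon : ι → Set (PadicAlgCl p)) (hUnon : ∀ i, IsOpen (Unon i))
    (Iarc Inon : Set ι)
    (hIarc : ∀ i ∈ Iarc, ∃ R : ℝ, ∀ z : ℂ, R < ‖z‖ → z ∈ Uarc i)
    (hInon : ∀ i ∈ Inon, ∃ R : ℝ, ∀ z : PadicAlgCl p, R < ‖z‖ → z ∈ Unon i)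
    (hcover : ∀ (a : Fin d → OnePoint ℂ) (b : Fin d → OnePoint (PadicAlgCl p)), ∃ i : ι,
      (∀ j, (∃ z ∈ Uarc i, a j = ↑z) ∨ (a j = ∞ ∧ i ∈ Iarc)) ∧
        (∀ j, (∃ z ∈ Unon i, b j = ↑z) ∨ (b j = ∞ ∧ i ∈ Inon)))
    (hV : ∀ i, VojtaIneq {P : NFPoint | (∀ σ : P.F →+* ℂ, σ P.x ∈ Uarc i) ∧
      (∀ σ : P.F →+* PadicAlgCl p, σ P.x ∈ Unon i)} d ε) :
    VojtaIneq Set.univ d ε := by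
  classical
  obtain ⟨s, hs⟩ :=
    exists_finset_cover_of_degree_le p d Uarc hUarc Unon hUnon Iarc Inon hIarc hInon hcover
  choose C hC using hV
  refine ⟨∑ i ∈ s, |C i|, fun P hP => ?_⟩
  obtain ⟨i, hi, happ⟩ := hs P hP.2.2
  calc P.ht - (1 + ε) * (P.logDiff + P.logCond) ≤ C i := hC i P ⟨happ, hP.2⟩
    _ ≤ |C i| := le_abs_self _
    _ ≤ ∑ i ∈ s, |C i| := Finset.single_le_sum (f := fun i => |C i|) (fun _ _ => abs_nonneg _) hi

/-! ## Monotone families: the covering hypothesis from EXACT (`r = 0`) avoidance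

In the application the mechanisms come in families `(k, n)`: a "limit" (exact) condition `k` and a
quantitative margin `r_n ↓ 0`, the applicability sets `Uarc k n`, `Unon k n` INCREASING in `n` (the
smaller the margin, the more points qualify). Then the covering hypothesis of
`exists_finset_cover_of_degree_le` for the family `(k, n)` follows from the purely qualitative
statement that every configuration lies, entrywise, in `⋃ n, Uarc k n` (resp. `⋃ n, Unon k n`, or is
`∞` for a `k` open at `∞`) for ONE `k`: a configuration has finitely many entries, so one margin
`n` serves all of them. -/

/-- **The covering hypothesis for a monotone family from exact avoidance.** For mechanisms indexed
by `κ × ℕ` with `Uarc k n`, `Unon k n` increasing in `n` and the flags at `∞` depending only on `k`: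
if every configuration of `d` points of `ℂ ∪ {∞}` and `d` points of `Q̄_p ∪ {∞}` lies, for a single
`k`, entrywise in `⋃ n, Uarc k n` (resp. `⋃ n, Unon k n`) or at an admissible `∞`, then every
configuration lies in a single mechanism `(k, n)` — the hypothesis `hcover` of
`exists_finset_cover_of_degree_le` / `vojtaIneq_univ_of_cover` for the family
`fun kn => Uarc kn.1 kn.2`. [cite: MochizukiGenEll2010, Thm 2.1 proof p.12] -/
theorem cover_of_monotone_of_exact (p : ℕ) [Fact p.Prime] (d : ℕ) {κ : Type*}
    (Uarc : κ → ℕ → Set ℂ) (Unon : κ → ℕ → Set (PadicAlgCl p)) (Iarc Inon : Set κ)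
    (hmonoArc : ∀ k n, Uarc k n ⊆ Uarc k (n + 1))
    (hmonoNon : ∀ k n, Unon k n ⊆ Unon k (n + 1))
    (hexact : ∀ (a : Fin d → OnePoint ℂ) (b : Fin d → OnePoint (PadicAlgCl p)), ∃ k : κ,
      (∀ j, (∃ n, ∃ z ∈ Uarc k n, a j = ↑z) ∨ (a j = ∞ ∧ k ∈ Iarc)) ∧
        (∀ j, (∃ n, ∃ z ∈ Unon k n, b j = ↑z) ∨ (b j = ∞ ∧ k ∈ Inon)))
    (a : Fin d → OnePoint ℂ) (b : Fin d → OnePoint (PadicAlgCl p)) :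
    ∃ i : κ × ℕ,
      (∀ j, (∃ z ∈ Uarc i.1 i.2, a j = ↑z) ∨ (a j = ∞ ∧ i ∈ {i : κ × ℕ | i.1 ∈ Iarc})) ∧
        (∀ j, (∃ z ∈ Unon i.1 i.2, b j = ↑z) ∨ (b j = ∞ ∧ i ∈ {i : κ × ℕ | i.1 ∈ Inon})) := by
  classical
  obtain ⟨k, ha, hb⟩ := hexact a b
  -- monotonicity along arbitrary `n ≤ m`
  have hmonoArc' : ∀ n m, n ≤ m → Uarc k n ⊆ Uarc k m := by
    intro n m hnm
    induction hnm with
    | refl => exact subset_rfl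
    | step _ ih => exact ih.trans (hmonoArc k _)
  have hmonoNon' : ∀ n m, n ≤ m → Unon k n ⊆ Unon k m := by
    intro n m hnm
    induction hnm with
    | refl => exact subset_rfl
    | step _ ih => exact ih.trans (hmonoNon k _)
  -- a margin for each entry (`0` for the entries at `∞`), and their maximum
  have hna : ∀ j, ∃ n, (∃ z ∈ Uarc k n, a j = ↑z) ∨ (a j = ∞ ∧ k ∈ Iarc) := by
    intro j
    rcases ha j with ⟨n, z, hz, hj⟩ | h
    · exact ⟨n, Or.inl ⟨z, hz, hj⟩⟩
    · exact ⟨0, Or.inr h⟩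
  have hnb : ∀ j, ∃ n, (∃ z ∈ Unon k n, b j = ↑z) ∨ (b j = ∞ ∧ k ∈ Inon) := by
    intro j
    rcases hb j with ⟨n, z, hz, hj⟩ | h
    · exact ⟨n, Or.inl ⟨z, hz, hj⟩⟩
    · exact ⟨0, Or.inr h⟩
  choose na hna' using hna
  choose nb hnb' using hnb
  let N : ℕ := (Finset.univ.sup na) ⊔ (Finset.univ.sup nb)
  have hNa : ∀ j, na j ≤ N := fun j =>
    (Finset.le_sup (f := na) (Finset.mem_univ j)).trans le_sup_left
  have hNb : ∀ j, nb j ≤ N := fun j =>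
    (Finset.le_sup (f := nb) (Finset.mem_univ j)).trans le_sup_right
  refine ⟨(k, N), fun j => ?_, fun j => ?_⟩
  · rcases hna' j with ⟨z, hz, hj⟩ | ⟨hj, hk⟩
    · exact Or.inl ⟨z, hmonoArc' _ _ (hNa j) hz, hj⟩
    · exact Or.inr ⟨hj, hk⟩
  · rcases hnb' j with ⟨z, hz, hj⟩ | ⟨hj, hk⟩
    · exact Or.inl ⟨z, hmonoNon' _ _ (hNb j) hz, hj⟩
    · exact Or.inr ⟨hj, hk⟩

/-- **Vojta in degree `≤ d` from a monotone family of mechanisms and exact avoidance** — the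
composite of `cover_of_monotone_of_exact` and `vojtaIneq_univ_of_cover`: open applicability sets
`Uarc k n ⊆ ℂ`, `Unon k n ⊆ Q̄_p` increasing in `n`, flags at `∞` depending on `k` (with the
punctured-neighbourhood condition for EVERY `n`), Vojta on the points to which each `(k, n)`
applies, and the qualitative covering of configurations by the unions `⋃ n` — give
`VojtaIneq Set.univ d ε`. [cite: MochizukiGenEll2010, Thm 2.1 proof p.12] -/
theorem vojtaIneq_univ_of_monotone_cover (p : ℕ) [Fact p.Prime] (d : ℕ) {ε : ℝ} {κ : Type*}
    (Uarc : κ → ℕ → Set ℂ) (hUarc : ∀ k n, IsOpen (Uarc k n))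
    (Unon : κ → ℕ → Set (PadicAlgCl p)) (hUnon : ∀ k n, IsOpen (Unon k n))
    (Iarc Inon : Set κ)
    (hIarc : ∀ k ∈ Iarc, ∀ n, ∃ R : ℝ, ∀ z : ℂ, R < ‖z‖ → z ∈ Uarc k n)
    (hInon : ∀ k ∈ Inon, ∀ n, ∃ R : ℝ, ∀ z : PadicAlgCl p, R < ‖z‖ → z ∈ Unon k n)
    (hmonoArc : ∀ k n, Uarc k n ⊆ Uarc k (n + 1))
    (hmonoNon : ∀ k n, Unon k n ⊆ Unon k (n + 1))
    (hexact : ∀ (a : Fin d → OnePoint ℂ) (b : Fin d → OnePoint (PadicAlgCl p)), ∃ k : κ,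
      (∀ j, (∃ n, ∃ z ∈ Uarc k n, a j = ↑z) ∨ (a j = ∞ ∧ k ∈ Iarc)) ∧
        (∀ j, (∃ n, ∃ z ∈ Unon k n, b j = ↑z) ∨ (b j = ∞ ∧ k ∈ Inon)))
    (hV : ∀ k n, VojtaIneq {P : NFPoint | (∀ σ : P.F →+* ℂ, σ P.x ∈ Uarc k n) ∧
      (∀ σ : P.F →+* PadicAlgCl p, σ P.x ∈ Unon k n)} d ε) :
    VojtaIneq Set.univ d ε :=
  vojtaIneq_univ_of_cover p d (fun i : κ × ℕ => Uarc i.1 i.2) (fun i => hUarc i.1 i.2)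
    (fun i => Unon i.1 i.2) (fun i => hUnon i.1 i.2) {i | i.1 ∈ Iarc} {i | i.1 ∈ Inon}
    (fun i hi => hIarc i.1 hi i.2) (fun i hi => hInon i.1 hi i.2)
    (cover_of_monotone_of_exact p d Uarc Unon Iarc Inon hmonoArc hmonoNon hexact)
    (fun i => hV i.1 i.2)

end Literature.NumberTheory.DiophantineGeometry.GenEll

end
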